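import Literature.MathematicalPhysics.QuantumLattice.Imbrie2016.LLA

/-!
# Imbrie (2016), Assumption LLA at zero transverse coupling: the γ = 0 case PROVED, ν = 1, C = 4·max(1, ρ₀)

CITATION HEADER (lean-in-tree rule 2026-08-18). J. Z. Imbrie, *On many-body localization for quantum spin chains*,
J. Stat. Phys. **163** (2016) 998–1048, doi 10.1007/s10955-016-1508-x, arXiv:1403.7837 [ImbrieJSP2016], eq. (1.1) (model),
p. 1000 (admissible laws: independent, |·| ≤ 1, densities ≤ ρ₀), eq. (1.3) = (5.2) (Assumption LLA(ν, C)).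
WHAT IS PROVED (a lemma of the audit cell `pub-imbrie`, NOT a statement of the paper — the paper assumes LLA for small γ > 0 and
proves nothing about it): for the typed objects of `Imbrie2016/LLA.lean`,
  * `eigs_zero_multiset`: at γ = 0 the multiset of the 2ⁿ eigenvalues of the box Hamiltonian `H 0 p` is the multiset of the
    configuration energies `diagEnergy p σ`, σ ∈ {±1}ⁿ (H 0 p is diagonal);
  * `boxMeasure_pairGap_le`: for laws admissible with density bound ρ₀ and two configurations σ ≠ τ differing at a site i,
    P(|E_σ − E_τ| ≤ δ) ≤ ρ₀ δ (the coefficient of h_i in E_σ − E_τ is ±2; average over h_i alone — a one-variable Wegner step);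
  * `boxMeasure_smallGap_zero_le`: P_{γ=0}(∃ α ≠ β : |E_α − E_β| < δ) ≤ ρ₀ 4ⁿ δ (union bound over the 2ⁿ(2ⁿ−1) ORDERED pairs;
    the cell's prose LLA.md §3 P1 counts unordered pairs and has ρ₀ 2^{2n−1} δ — the factor 2 is not formalised);
  * `LLA_zero_coupling`: hence `LLA L 0 1 (4 * max 1 ρ₀)` for every family of laws `L` admissible with bound ρ₀ ≥ 0, i.e.
    eq. (1.3) holds in the decoupled case with ν = 1 (neutral statistics) and C = 4 max(1, ρ₀).
The event {two distinct configurations have γ = 0 energies within δ} and its bound `boxMeasure_cfgClose_le` are stated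
separately because the Weyl-window bound for γ > 0 (cell LLA.md §3 P2) reduces to the same event at scale δ + 2γn.
(No new definitions: everything is stated over `diagEnergy`, `Params.ofTriple`, `Laws.boxMeasure`, `SmallGap`, `LLA`.)
STATUS: unconditional theorems about the γ = 0 (classical, diagonal) model; they say NOTHING about LLA for γ > 0, which remains
the unproved hypothesis of [ImbrieJSP2016] Thm 1.1 (cell verdict: open). Unit b2b-imbrie-1-g3 (gen 3 of the LLA seat).
-/

noncomputable section
open _root_.MeasureTheory Polynomial Finset
open scoped ENNReal

namespace Literature.MathematicalPhysics.QuantumLattice.Imbrie2016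

variable {n : ℕ}

/-! ## The γ = 0 Hamiltonian is diagonal -/

/-- at γ = 0 the S^x part of (1.1) vanishes. [cite: ImbrieJSP2016, eq. (1.1)] -/
theorem offDiag_zero (p : Params n) (σ τ : Cfg n) : offDiag 0 p σ τ = 0 := by
  unfold offDiag; simp

/-- at γ = 0 the box Hamiltonian is the diagonal matrix of configuration energies. [cite: ImbrieJSP2016, eq. (1.1)] -/
theorem H_zero (p : Params n) : H 0 p = Matrix.diagonal (diagEnergy p) := by
  unfold H; ext σ τ; simp [offDiag_zero]

/-- at γ = 0 the multiset of the 2ⁿ eigenvalues (with multiplicity) is the multiset of configuration energies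
(roots of the characteristic polynomial of a diagonal matrix). [cite: ImbrieJSP2016, eq. (1.1)] -/
theorem eigs_zero_multiset (p : Params n) :
    Multiset.map (eigs 0 p) univ.val = Multiset.map (diagEnergy p) univ.val := by
  have h1 := (H_isHermitian 0 p).roots_charpoly_eq_eigenvalues
  have h2 : (H 0 p).charpoly = ∏ i, (X - C (diagEnergy p i)) := by
    rw [H_zero]; exact Matrix.charpoly_diagonal _
  have h3 : (∏ i, (X - C (diagEnergy p i)) : ℝ[X]).roots = Multiset.map (diagEnergy p) univ.val := by
    have : (∏ i, (X - C (diagEnergy p i)) : ℝ[X]) =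
        ((Multiset.map (diagEnergy p) univ.val).map fun a => X - C a).prod := by
      rw [Finset.prod_eq_multiset_prod, Multiset.map_map]; rfl
    rw [this]; exact Polynomial.roots_multiset_prod_X_sub_C _
  rw [h2, h3] at h1
  have h4 : (RCLike.ofReal ∘ eigs 0 p : Cfg n → ℝ) = eigs 0 p := by funext σ; simp [eigs]
  rw [← h4]; exact h1.symm

/-- **γ = 0 reduction**: a gap < δ between two distinct eigenvalue INDICES is a difference < δ between the energies of
two distinct CONFIGURATIONS (a repeated eigenvalue is a repeated configuration energy). [cite: ImbrieJSP2016, eq. (1.3)] -/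
theorem exists_cfg_pair_of_smallGap_zero {δ : ℝ} {p : Params n} (h : SmallGap 0 δ p) :
    ∃ σ τ : Cfg n, σ ≠ τ ∧ |diagEnergy p σ - diagEnergy p τ| < δ := by
  obtain ⟨α, β, hne, hlt⟩ := h
  have hM := eigs_zero_multiset p
  have hδ : 0 < δ := lt_of_le_of_lt (abs_nonneg _) hlt
  by_cases heq : eigs 0 p α = eigs 0 p β
  · -- a repeated eigenvalue: two configurations with the same energy
    set v := eigs 0 p α with hv
    have hcount : 2 ≤ Multiset.count v (Multiset.map (diagEnergy p) univ.val) := by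
      rw [← hM, Multiset.count_map]
      have hsub : ({α, β} : Finset (Cfg n)) ⊆ univ.filter (fun σ => v = eigs 0 p σ) := by
        intro σ hσ
        simp only [Finset.mem_insert, Finset.mem_singleton] at hσ
        rcases hσ with rfl | rfl
        · simp [Finset.mem_filter, hv]
        · simp only [Finset.mem_filter, Finset.mem_univ, true_and]; exact heq
      have hcard : ({α, β} : Finset (Cfg n)).card = 2 := Finset.card_pair hne
      calc 2 = ({α, β} : Finset (Cfg n)).card := hcard.symm
        _ ≤ (univ.filter (fun σ => v = eigs 0 p σ)).card := Finset.card_le_card hsub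
        _ = Multiset.card (Multiset.filter (fun σ => v = eigs 0 p σ) univ.val) := by
            rw [Finset.card_def, Finset.filter_val]
    rw [Multiset.count_map] at hcount
    have hcount' : 1 < (univ.filter (fun σ => v = diagEnergy p σ)).card := by
      rw [Finset.card_def, Finset.filter_val]; omega
    obtain ⟨σ, hσ, τ, hτ, hστ⟩ := Finset.one_lt_card.mp hcount'
    simp only [Finset.mem_filter, Finset.mem_univ, true_and] at hσ hτ
    refine ⟨σ, τ, hστ, ?_⟩
    rw [← hσ, ← hτ, sub_self, abs_zero]; exact hδ
  · have hα : eigs 0 p α ∈ Multiset.map (diagEnergy p) univ.val := by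
      rw [← hM]; exact Multiset.mem_map_of_mem _ (Finset.mem_univ _)
    have hβ : eigs 0 p β ∈ Multiset.map (diagEnergy p) univ.val := by
      rw [← hM]; exact Multiset.mem_map_of_mem _ (Finset.mem_univ _)
    obtain ⟨σ, -, hσ⟩ := Multiset.mem_map.mp hα
    obtain ⟨τ, -, hτ⟩ := Multiset.mem_map.mp hβ
    refine ⟨σ, τ, ?_, ?_⟩
    · rintro rfl; exact heq (by rw [← hσ, ← hτ])
    · rw [hσ, hτ]; exact hlt

/-! ## E_σ − E_τ as an affine form in the couplings -/

/-- the γ = 0 gap `E_σ − E_τ` is a continuous function of the couplings (h, Γ, J). [folklore] -/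
theorem continuous_diagEnergy_sub (σ τ : Cfg n) :
    Continuous fun t : (Fin n → ℝ) × (Fin n → ℝ) × (Fin (n + 1) → ℝ) =>
      diagEnergy (Params.ofTriple t) σ - diagEnergy (Params.ofTriple t) τ := by
  unfold diagEnergy Params.ofTriple
  fun_prop

/-- the event `|E_σ − E_τ| ≤ δ` (γ = 0) is measurable in the couplings. [folklore] -/
theorem measurableSet_diagEnergy_sub_le (σ τ : Cfg n) (δ : ℝ) :
    MeasurableSet {t : (Fin n → ℝ) × (Fin n → ℝ) × (Fin (n + 1) → ℝ) |
      |diagEnergy (Params.ofTriple t) σ - diagEnergy (Params.ofTriple t) τ| ≤ δ} :=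
  measurableSet_le (continuous_diagEnergy_sub σ τ).abs.measurable measurable_const

/-- `E_σ − E_τ` is affine in the single field variable `h_i`, with slope `szZ σ i − szZ τ i`. [cite: ImbrieJSP2016, eq. (1.1)] -/
theorem diagEnergy_sub_update (σ τ : Cfg n) (x : Fin n → ℝ) (y : (Fin n → ℝ) × (Fin (n + 1) → ℝ))
    (i : Fin n) (w : ℝ) :
    diagEnergy (Params.ofTriple (Function.update x i w, y)) σ
        - diagEnergy (Params.ofTriple (Function.update x i w, y)) τ =
      w * (szZ σ i - szZ τ i) +
        (diagEnergy (Params.ofTriple (Function.update x i 0, y)) σ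
          - diagEnergy (Params.ofTriple (Function.update x i 0, y)) τ) := by
  simp only [diagEnergy, Params.ofTriple]
  have key : ∀ (ρ : Cfg n) (j : Fin n), Function.update x i w j * szZ ρ j =
      Function.update x i 0 j * szZ ρ j + (if j = i then w * szZ ρ j else 0) := by
    intro ρ j
    by_cases hj : j = i
    · subst hj; simp
    · simp [hj]
  simp_rw [key, Finset.sum_add_distrib, Finset.sum_ite_eq' univ i, if_pos (Finset.mem_univ i)]
  ring

/-- S^z of a box site `i : Fin n` read through the ℤ-indexed `szZ`. [cite: ImbrieJSP2016, eq. (1.1)] -/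
theorem szZ_site (σ : Cfg n) (i : Fin n) : szZ σ (i : ℤ) = if σ i then 1 else -1 := by
  unfold szZ
  have h : (0 : ℤ) ≤ (i : ℤ) ∧ (i : ℤ) < n := ⟨by positivity, by exact_mod_cast i.isLt⟩
  rw [dif_pos h]
  have : (⟨((i : ℤ)).toNat, by omega⟩ : Fin n) = i := by ext; simp
  rw [this]

/-- the coefficient of `h_i` in `E_σ − E_τ` is ±2 at a site where σ and τ differ. [cite: ImbrieJSP2016, eq. (1.1)] -/
theorem abs_szZ_sub_eq_two {σ τ : Cfg n} {i : Fin n} (h : σ i ≠ τ i) :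
    |szZ σ (i : ℤ) - szZ τ (i : ℤ)| = 2 := by
  rw [szZ_site, szZ_site]
  cases hσ : σ i <;> cases hτ : τ i <;> simp_all <;> norm_num

/-! ## Measure-theoretic tools: one-coordinate Fubini bound, interval mass of an admissible law -/

/-- **One-coordinate Fubini bound.** If every section of `S` in coordinate `i` has `μ i`-measure `≤ c`,
then the product (probability) measure of `S` is `≤ c`. [folklore] -/
theorem pi_measure_le_of_sections {μ : Fin n → Measure ℝ} [∀ j, IsProbabilityMeasure (μ j)]
    {S : Set (Fin n → ℝ)} (hS : MeasurableSet S) (i : Fin n) (c : ℝ≥0∞)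
    (h : ∀ x : Fin n → ℝ, μ i {w | Function.update x i w ∈ S} ≤ c) :
    Measure.pi μ S ≤ c := by
  classical
  rw [← lintegral_indicator_one hS]
  have hf : Measurable (S.indicator (1 : (Fin n → ℝ) → ℝ≥0∞)) := measurable_one.indicator hS
  have hg : Measurable (fun _ : Fin n → ℝ => c) := measurable_const
  calc ∫⁻ x, S.indicator 1 x ∂Measure.pi μ ≤ ∫⁻ x, (fun _ => c) x ∂Measure.pi μ := by
        refine lintegral_le_of_lmarginal_le {i} hf hg (fun x => ?_)
        rw [lmarginal_singleton, lmarginal_singleton]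
        simp only
        have e : (fun w => S.indicator (1 : (Fin n → ℝ) → ℝ≥0∞) (Function.update x i w)) =
            {w | Function.update x i w ∈ S}.indicator 1 := by
          funext w
          by_cases hw : Function.update x i w ∈ S <;> simp [Set.indicator, hw]
        have hT : MeasurableSet {w | Function.update x i w ∈ S} := hS.preimage (measurable_update x)
        rw [e, lintegral_indicator_one hT, lintegral_const, measure_univ, mul_one]
        exact h x
    _ = c := by rw [lintegral_const, measure_univ, mul_one]

/-- an admissible law (density ≤ ρ₀ on [−1, 1]) gives mass ≤ ρ₀ · 2r to any interval [z − r, z + r].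
[cite: ImbrieJSP2016, p. 1000] -/
theorem Admissible.measure_closedBall_le {ρ₀ : ℝ} {μ : Measure ℝ} (hμ : Admissible ρ₀ μ)
    (hρ : 0 ≤ ρ₀) (z r : ℝ) :
    μ (Metric.closedBall z r) ≤ ENNReal.ofReal (ρ₀ * (2 * r)) := by
  have h1 := (Measure.le_iff'.1 hμ.2) (Metric.closedBall z r)
  refine h1.trans ?_
  rw [Measure.smul_apply, smul_eq_mul, Measure.restrict_apply Metric.isClosed_closedBall.measurableSet,
    ENNReal.ofReal_mul hρ]
  gcongr
  calc volume (Metric.closedBall z r ∩ Set.Icc (-1 : ℝ) 1) ≤ volume (Metric.closedBall z r) :=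
        measure_mono Set.inter_subset_left
    _ = ENNReal.ofReal (2 * r) := Real.volume_closedBall z r

/-! ## The γ = 0 Wegner step, the union bound, and LLA(1, 4 max(1, ρ₀)) at γ = 0 -/

/-- **The γ = 0 Wegner step for one pair.** For admissible laws and two configurations differing at a
site `i`, `P(|E_σ − E_τ| ≤ δ) ≤ ρ₀ δ` (average over `h_i` alone: slope ±2, so `h_i` is confined to an interval of
length δ). Audit-cell lemma (LLA.md §3 P1), not in the paper. [cite: ImbrieJSP2016, eq. (1.3)] -/
theorem boxMeasure_pairGap_le {L : Laws} {ρ₀ : ℝ} (hL : L.Admissible ρ₀) (hρ : 0 ≤ ρ₀) (a : ℤ)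
    {σ τ : Cfg n} {i : Fin n} (hi : σ i ≠ τ i) (δ : ℝ) :
    L.boxMeasure a n {t | |diagEnergy (Params.ofTriple t) σ - diagEnergy (Params.ofTriple t) τ| ≤ δ}
      ≤ ENNReal.ofReal (ρ₀ * δ) := by
  haveI : ∀ k, IsProbabilityMeasure (L.μh k) := fun k => (hL k).1.1
  haveI : ∀ k, IsProbabilityMeasure (L.μΓ k) := fun k => (hL k).2.1.1
  haveI : ∀ k, IsProbabilityMeasure (L.μJ k) := fun k => (hL k).2.2.1
  have hS := measurableSet_diagEnergy_sub_le (n := n) σ τ δ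
  unfold Laws.boxMeasure
  rw [Measure.prod_apply_symm hS]
  have hc : |szZ σ i - szZ τ i| = 2 := abs_szZ_sub_eq_two hi
  have hc0 : szZ σ (i : ℤ) - szZ τ (i : ℤ) ≠ 0 := by
    intro h0; rw [h0, abs_zero] at hc; norm_num at hc
  have hsec : ∀ y : (Fin n → ℝ) × (Fin (n + 1) → ℝ),
      (Measure.pi fun j : Fin n => L.μh (a + j))
        ((fun x => (x, y)) ⁻¹' {t : ((Fin n → ℝ) × (Fin n → ℝ) × (Fin (n + 1) → ℝ)) |
          |diagEnergy (Params.ofTriple t) σ - diagEnergy (Params.ofTriple t) τ| ≤ δ})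
          ≤ ENNReal.ofReal (ρ₀ * δ) := by
    intro y
    refine pi_measure_le_of_sections (hS.preimage (by fun_prop)) i _ (fun x => ?_)
    set c : ℝ := szZ σ i - szZ τ i with hcdef
    set R : ℝ := diagEnergy (Params.ofTriple (Function.update x i 0, y)) σ
        - diagEnergy (Params.ofTriple (Function.update x i 0, y)) τ with hR
    have hsub : {w | Function.update x i w ∈ (fun x => (x, y)) ⁻¹' {t : ((Fin n → ℝ) × (Fin n → ℝ) × (Fin (n + 1) → ℝ)) |
          |diagEnergy (Params.ofTriple t) σ - diagEnergy (Params.ofTriple t) τ| ≤ δ}}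
        ⊆ Metric.closedBall (-R / c) (δ / 2) := by
      intro w hw
      simp only [Set.mem_setOf_eq, Set.mem_preimage] at hw
      rw [diagEnergy_sub_update, ← hcdef, ← hR] at hw
      rw [Metric.mem_closedBall, Real.dist_eq]
      have e : w * c + R = c * (w - (-R / c)) := by field_simp; ring
      rw [e, abs_mul, hc] at hw
      linarith
    calc (L.μh (a + i)) {w | Function.update x i w ∈ (fun x => (x, y)) ⁻¹' {t : ((Fin n → ℝ) × (Fin n → ℝ) × (Fin (n + 1) → ℝ)) |
            |diagEnergy (Params.ofTriple t) σ - diagEnergy (Params.ofTriple t) τ| ≤ δ}}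
        ≤ (L.μh (a + i)) (Metric.closedBall (-R / c) (δ / 2)) := measure_mono hsub
      _ ≤ ENNReal.ofReal (ρ₀ * (2 * (δ / 2))) := (hL (a + i)).1.measure_closedBall_le hρ _ _
      _ = ENNReal.ofReal (ρ₀ * δ) := by ring_nf
  calc ∫⁻ y, (Measure.pi fun j : Fin n => L.μh (a + j))
          ((fun x => (x, y)) ⁻¹' {t : ((Fin n → ℝ) × (Fin n → ℝ) × (Fin (n + 1) → ℝ)) |
            |diagEnergy (Params.ofTriple t) σ - diagEnergy (Params.ofTriple t) τ| ≤ δ})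
          ∂((Measure.pi fun j : Fin n => L.μΓ (a + j)).prod (Measure.pi fun b : Fin (n + 1) => L.μJ (a + b - 1)))
        ≤ ∫⁻ y, ENNReal.ofReal (ρ₀ * δ)
          ∂((Measure.pi fun j : Fin n => L.μΓ (a + j)).prod (Measure.pi fun b : Fin (n + 1) => L.μJ (a + b - 1))) :=
        lintegral_mono hsec
    _ = ENNReal.ofReal (ρ₀ * δ) := by rw [lintegral_const, measure_univ, mul_one]

/-- an n-site box has 2ⁿ configurations. [folklore] -/
theorem card_cfg (n : ℕ) : Fintype.card (Cfg n) = 2 ^ n := by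
  simp [Cfg]

/-- **Union bound over ordered pairs** (the γ = 0 count of the cell's LLA.md §3 P1, ordered-pair version):
P(two distinct configurations have γ = 0 energies within δ) ≤ ρ₀ 4ⁿ δ. [cite: ImbrieJSP2016, eq. (1.3)] -/
theorem boxMeasure_cfgClose_le {L : Laws} {ρ₀ : ℝ} (hL : L.Admissible ρ₀) (hρ : 0 ≤ ρ₀) (a : ℤ)
    (n : ℕ) (δ : ℝ) :
    L.boxMeasure a n {t | ∃ σ τ : Cfg n, σ ≠ τ ∧
        |diagEnergy (Params.ofTriple t) σ - diagEnergy (Params.ofTriple t) τ| ≤ δ}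
      ≤ ENNReal.ofReal (ρ₀ * 4 ^ n * δ) := by
  classical
  set F : Cfg n × Cfg n → Set ((Fin n → ℝ) × (Fin n → ℝ) × (Fin (n + 1) → ℝ)) :=
    fun q => {t | |diagEnergy (Params.ofTriple t) q.1 - diagEnergy (Params.ofTriple t) q.2| ≤ δ} with hF
  have hsub : {t : ((Fin n → ℝ) × (Fin n → ℝ) × (Fin (n + 1) → ℝ)) | ∃ σ τ : Cfg n, σ ≠ τ ∧
      |diagEnergy (Params.ofTriple t) σ - diagEnergy (Params.ofTriple t) τ| ≤ δ}
        ⊆ ⋃ q ∈ (univ : Finset (Cfg n)).offDiag, F q := by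
    rintro t ⟨σ, τ, hne, ht⟩
    refine Set.mem_iUnion₂.mpr ⟨(σ, τ), ?_, ht⟩
    simp [Finset.mem_offDiag, hne]
  have hcard : (((univ : Finset (Cfg n)).offDiag.card : ℕ) : ℝ) ≤ 4 ^ n := by
    rw [Finset.offDiag_card, Finset.card_univ, card_cfg]
    have h1 : (2 ^ n * 2 ^ n - 2 ^ n : ℕ) ≤ 2 ^ n * 2 ^ n := Nat.sub_le _ _
    have h2 : ((2 ^ n * 2 ^ n : ℕ) : ℝ) = 4 ^ n := by
      push_cast
      rw [← mul_pow]; norm_num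
    calc ((2 ^ n * 2 ^ n - 2 ^ n : ℕ) : ℝ) ≤ ((2 ^ n * 2 ^ n : ℕ) : ℝ) := by exact_mod_cast h1
      _ = 4 ^ n := h2
  calc L.boxMeasure a n {t | ∃ σ τ : Cfg n, σ ≠ τ ∧
          |diagEnergy (Params.ofTriple t) σ - diagEnergy (Params.ofTriple t) τ| ≤ δ}
      ≤ L.boxMeasure a n (⋃ q ∈ (univ : Finset (Cfg n)).offDiag, F q) := measure_mono hsub
    _ ≤ ∑ q ∈ (univ : Finset (Cfg n)).offDiag, L.boxMeasure a n (F q) :=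
        measure_biUnion_finset_le _ _
    _ ≤ ∑ q ∈ (univ : Finset (Cfg n)).offDiag, ENNReal.ofReal (ρ₀ * δ) := by
        refine Finset.sum_le_sum fun q hq => ?_
        have hne : q.1 ≠ q.2 := (Finset.mem_offDiag.mp hq).2.2
        obtain ⟨i, hi⟩ := Function.ne_iff.mp hne
        exact boxMeasure_pairGap_le hL hρ a hi δ
    _ = ((univ : Finset (Cfg n)).offDiag.card : ℝ≥0∞) * ENNReal.ofReal (ρ₀ * δ) := by
        rw [Finset.sum_const, nsmul_eq_mul]
    _ ≤ ENNReal.ofReal (4 ^ n) * ENNReal.ofReal (ρ₀ * δ) := by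
        gcongr
        rw [← ENNReal.ofReal_natCast]
        exact ENNReal.ofReal_le_ofReal hcard
    _ = ENNReal.ofReal (ρ₀ * 4 ^ n * δ) := by
        rw [← ENNReal.ofReal_mul (by positivity)]
        ring_nf

/-- at γ = 0 the small-gap event `SmallGap 0 δ` is contained in the configuration-coincidence event.
[cite: ImbrieJSP2016, eq. (1.3)] -/
theorem smallGap_zero_subset_cfgClose (n : ℕ) (δ : ℝ) :
    {t : ((Fin n → ℝ) × (Fin n → ℝ) × (Fin (n + 1) → ℝ)) | SmallGap 0 δ (Params.ofTriple t)}
      ⊆ {t | ∃ σ τ : Cfg n, σ ≠ τ ∧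
          |diagEnergy (Params.ofTriple t) σ - diagEnergy (Params.ofTriple t) τ| ≤ δ} := by
  intro t ht
  obtain ⟨σ, τ, hne, hlt⟩ := exists_cfg_pair_of_smallGap_zero ht
  exact ⟨σ, τ, hne, hlt.le⟩

/-- **P1 of the audit cell (LLA.md §3): at γ = 0, P(min gap < δ) ≤ ρ₀ 4ⁿ δ** for every box [a, a+n−1] and every real δ (trivial for δ < 0).
[cite: ImbrieJSP2016, eq. (1.3)] -/
theorem boxMeasure_smallGap_zero_le {L : Laws} {ρ₀ : ℝ} (hL : L.Admissible ρ₀) (hρ : 0 ≤ ρ₀)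
    (a : ℤ) (n : ℕ) (δ : ℝ) :
    L.boxMeasure a n {t | SmallGap 0 δ (Params.ofTriple t)} ≤ ENNReal.ofReal (ρ₀ * 4 ^ n * δ) :=
  (measure_mono (smallGap_zero_subset_cfgClose n δ)).trans (boxMeasure_cfgClose_le hL hρ a n δ)

/-- **LLA(1, 4·max(1, ρ₀)) holds at γ = 0**: Imbrie's Assumption (1.3) in the decoupled case, with exponent ν = 1
(neutral statistics) and C = 4 max(1, ρ₀), for every family of laws admissible with density bound ρ₀ ≥ 0.
Audit-cell theorem (REPAIR-CENSUS V1 / STEPS S5), not a statement of the paper. [cite: ImbrieJSP2016, eq. (1.3)] -/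
theorem LLA_zero_coupling {L : Laws} {ρ₀ : ℝ} (hL : L.Admissible ρ₀) (hρ : 0 ≤ ρ₀) :
    LLA L 0 1 (4 * max 1 ρ₀) := by
  intro a n hn δ hδ
  refine (boxMeasure_smallGap_zero_le hL hρ a n δ).trans (ENNReal.ofReal_le_ofReal ?_)
  rw [Real.rpow_one, mul_pow]
  have hm1 : (1 : ℝ) ≤ max 1 ρ₀ := le_max_left _ _
  have hρm : ρ₀ ≤ max 1 ρ₀ := le_max_right _ _
  have hmn : max 1 ρ₀ ≤ (max 1 ρ₀) ^ n := by
    calc max 1 ρ₀ = (max 1 ρ₀) ^ 1 := (pow_one _).symm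
      _ ≤ (max 1 ρ₀) ^ n := pow_le_pow_right₀ hm1 hn
  calc ρ₀ * 4 ^ n * δ = ρ₀ * (4 ^ n * δ) := by ring
    _ ≤ (max 1 ρ₀) ^ n * (4 ^ n * δ) :=
        mul_le_mul_of_nonneg_right (hρm.trans hmn) (by positivity)
    _ = δ * (4 ^ n * (max 1 ρ₀) ^ n) := by ring

end Literature.MathematicalPhysics.QuantumLattice.Imbrie2016
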